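import Literature.AlgebraicGeometry.Pohlmann1968.NondegenerateCMTypeDivisorClasses
import Mathlib.Algebra.Group.Action.Sigma
import HarnessLib

/-!
# Splitting of balanced weights on a CM algebra, and the dichotomy «divisor pairs or Weil section»

Combinatorics of Pohlmann's Galois condition (Gao–Ullmo 2025, Thm. 3.1 (3.2); Gordon 1999, (9.2.1)) on the index set
`Hom(∏_i K_i, ℂ) = ⊔_i Hom(K_i, ℂ)` of a CM ALGEBRA (the tree's `IsGaloisBalancedAlg Φ S`,
`Pohlmann1968/HodgeClassesCMAlgebra`; any finite family of CM fields `K_i`, any CM types `Φ_i`, repetitions allowed),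
written for the cell `pub-hodgecm2` (COR-CM) as the combinatorial half of «the Hodge conjecture for complex abelian
varieties of CM type of dimension `4` follows from the algebraicity of the Weil classes of abelian fourfolds»
(the CM slice of Moonen–Zarhin 1999, Thm. 0.1, with a different, elementary proof).  Everything is PROVED; no
definition, no named fact.  `Aut(ℂ) = ℂ ≃+* ℂ` acts on `⊔_i Hom(K_i, ℂ)` by composition (the tree's scoped
`ringEquivCompAction` on each `Hom(K_i, ℂ)` and Mathlib's `Sigma` action; `τ • (i, s) = (i, τ ∘ s)`), complex
conjugation is `ρ = starRingAut`, and `τ • S`, `ρ • S` are the pointwise images of a weight `S`.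

* `ncard_sep_union_of_disjoint`, `isGaloisBalancedAlg_union`, `isGaloisBalancedAlg_of_union_left` — the Galois
  condition is additive over disjoint unions (removing a balanced sub-weight leaves a balanced weight);
* `isGaloisBalancedAlg_pair_conj` — a conjugate pair `{x, x̄}` is balanced;
* **`isGaloisBalancedAlg_split`** — THE SPLITTING LEMMA: if `A ⊔ D` and `A ⊔ D̄` are both balanced (`D̄ = ρ • D`),
  then `A` and `D` are balanced (add and subtract the two counting identities);
* `isGaloisBalancedAlg_smul` — balancedness is invariant under `τ ∈ Aut(ℂ)`;
* sequel `CorCM/CMWeilSectionDichotomy`: the DICHOTOMY for balanced full sections (`τ • S ∈ {S, ρ • S}` for all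
  `τ`, or `S` splits into two nonempty balanced weights) and the 8-embedding case «divisor pairs or Weil section».

The geometric reading (realisations, the endomorphism `√-d` cut out by a Weil section, Markman's theorem) is in the
companion files `CorCM/CMWeilSectionEndomorphism` and `CorCM/CMProductFourfoldsOfMarkman` (cell `pub-hodgecm2`,
count-neutral sub-row A3-CM45-products; HONEST FRAMING: structure lemmas only, no case of the Hodge conjecture is
proved here and `HC_CM` is never asserted).

## References

* [GaoUllmo2025] Z. Gao, E. Ullmo, J. Inst. Math. Jussieu 25 (2025), Thm. 3.1 (3.2).
* [Gordon1999HodgeAVSurvey] B. B. Gordon, *A survey of the Hodge conjecture for abelian varieties*, §9.2 (9.2.1), 9.2.2.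
* [MoonenZarhin1999LowDim] B. Moonen, Yu. Zarhin, Math. Ann. 315 (1999) 711–733, Thm. 0.1.
* [Shimura1998] G. Shimura, *Abelian Varieties with Complex Multiplication and Modular Functions*, §18.2 Lemma (i).

Provenance: Literature home (family `hodge`, namespace `Literature.AlgebraicGeometry.ComplexMultiplication.CMWeights`) of the Summits-side `CorCM/CMBalancedWeightSplitting` (cell `pub-hodgecm2`, COR-CM; all its imports are `Literature/` and Mathlib), which `Literature/` may not import; theorems only, no named fact, no definition. Nothing here bears on `HC_CM`. Lane `lit-hodgefound` (Layer A3: CM types, their Kubota ranks and Galois combinatorics), seat p20.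
-/

noncomputable section

open NumberField

namespace Literature.AlgebraicGeometry.ComplexMultiplication.CMWeights

open Literature.AlgebraicGeometry.Motives (CMType)
open Literature.AlgebraicGeometry.Pohlmann1968
open Literature.NumberTheory.ComplexMultiplication

open scoped Classical Pointwise

/-! ### §1 Counting over disjoint unions -/

section Counting

variable {n : ℕ} {K : Fin n → Type} [∀ i, Field (K i)]

/-- Counting the members of a disjoint union `s ∪ t` with a property: the counts add. [cite: GaoUllmo2025, Thm. 3.1 (3.2)] -/
theorem ncard_sep_union_of_disjoint {α : Type*} [DecidableEq α] {s t : Finset α} (hst : Disjoint s t)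
    (Q : α → Prop) :
    {x | x ∈ s ∪ t ∧ Q x}.ncard = {x | x ∈ s ∧ Q x}.ncard + {x | x ∈ t ∧ Q x}.ncard := by
  have hdisj : Disjoint {x | x ∈ s ∧ Q x} {x | x ∈ t ∧ Q x} :=
    Set.disjoint_left.mpr fun x hx hx' => Finset.disjoint_left.1 hst hx.1 hx'.1
  have hfin₁ : {x | x ∈ s ∧ Q x}.Finite := s.finite_toSet.subset fun x hx => hx.1
  have hfin₂ : {x | x ∈ t ∧ Q x}.Finite := t.finite_toSet.subset fun x hx => hx.1
  rw [← Set.ncard_union_eq hdisj hfin₁ hfin₂]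
  congr 1
  ext x
  simp only [Set.mem_setOf_eq, Set.mem_union, Finset.mem_union]
  tauto

/-- A disjoint union `S ∪ T` of balanced weights is balanced. [cite: GaoUllmo2025, Thm. 3.1 (3.2)] -/
theorem isGaloisBalancedAlg_union {Φ : ∀ i, CMType (K i)} {S T : Finset ((i : Fin n) × (K i →+* ℂ))}
    (hS : IsGaloisBalancedAlg Φ S) (hT : IsGaloisBalancedAlg Φ T) (hST : Disjoint S T) :
    IsGaloisBalancedAlg Φ (S ∪ T) := by
  intro τ
  rw [ncard_sep_union_of_disjoint hST, ncard_sep_union_of_disjoint hST, hS τ, hT τ]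

/-- **Removing a balanced sub-weight leaves a balanced weight**: if `S ∪ T` (disjoint) and `S` satisfy Pohlmann's
condition, so does `T` (the condition is additive). [cite: Gordon1999HodgeAVSurvey, §9.2 (9.2.1)] -/
theorem isGaloisBalancedAlg_of_union_left {Φ : ∀ i, CMType (K i)} {S T : Finset ((i : Fin n) × (K i →+* ℂ))}
    (hST : IsGaloisBalancedAlg Φ (S ∪ T)) (hS : IsGaloisBalancedAlg Φ S) (hd : Disjoint S T) :
    IsGaloisBalancedAlg Φ T := by
  intro τ
  have h1 := hST τ
  rw [ncard_sep_union_of_disjoint hd, ncard_sep_union_of_disjoint hd] at h1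
  have h2 := hS τ
  omega

/-- The cardinality of a balanced weight is even (twice the number of its members in `Φ`).
[cite: GaoUllmo2025, Thm. 3.1 (3.2)] -/
theorem even_card_of_isGaloisBalancedAlg {Φ : ∀ i, CMType (K i)} {S : Finset ((i : Fin n) × (K i →+* ℂ))}
    (hS : IsGaloisBalancedAlg Φ S) : Even S.card :=
  ⟨_, by rw [hS.card_eq_two_mul]; ring⟩

end Counting

/-! ### §2 The action of `Aut(ℂ)` and complex conjugation on `⊔_i Hom(K_i, ℂ)` -/

section Action

variable {n : ℕ} {K : Fin n → Type} [∀ i, Field (K i)] [∀ i, NumberField (K i)] [∀ i, IsCMField (K i)]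

omit [∀ i, NumberField (K i)] [∀ i, IsCMField (K i)] in
/-- `τ • (i, s) = (i, τ ∘ s)` (Mathlib's `Sigma` action over the scoped `ringEquivCompAction`). [cite: GaoUllmo2025, Thm. 3.1 (3.2)] -/
theorem smul_sigma_eq (τ : ℂ ≃+* ℂ) (x : (i : Fin n) × (K i →+* ℂ)) :
    τ • x = ⟨x.1, (τ : ℂ →+* ℂ).comp x.2⟩ := rfl

omit [∀ i, NumberField (K i)] [∀ i, IsCMField (K i)] in
/-- `ρ • (i, s) = (i, s̄)` for complex conjugation `ρ = starRingAut`. [cite: GaoUllmo2025, Thm. 3.1 (3.2)] -/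
theorem conj_smul_sigma_eq (x : (i : Fin n) × (K i →+* ℂ)) :
    (starRingAut : ℂ ≃+* ℂ) • x = ⟨x.1, ComplexEmbedding.conjugate x.2⟩ := by
  rw [smul_sigma_eq]
  exact congrArg (Sigma.mk x.1) (conj_smul_eq_conjugate x.2)

/-- For CM fields, `τ ∈ Aut(ℂ)` commutes with complex conjugation on `⊔_i Hom(K_i, ℂ)`:
`τ • ρ • x = ρ • τ • x` (complex conjugation of `K_i` commutes with every embedding, Shimura §18.2 Lemma (i); Mathlib
`IsCMField.complexEmbedding_complexConj`). [cite: Shimura1998, §18.2 Lemma (i)] -/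
theorem smul_conj_smul_comm (τ : ℂ ≃+* ℂ) (x : (i : Fin n) × (K i →+* ℂ)) :
    τ • (starRingAut : ℂ ≃+* ℂ) • x = (starRingAut : ℂ ≃+* ℂ) • τ • x := by
  obtain ⟨i, s⟩ := x
  rw [smul_sigma_eq, smul_sigma_eq, smul_sigma_eq, smul_sigma_eq]
  refine congrArg (Sigma.mk i) (RingHom.ext fun a => ?_)
  change τ (starRingEnd ℂ (s a)) = starRingEnd ℂ (τ (s a))
  rw [← IsCMField.complexEmbedding_complexConj (K i) s a]
  exact IsCMField.complexEmbedding_complexConj (K i) ((τ : ℂ →+* ℂ).comp s) a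

omit [∀ i, NumberField (K i)] [∀ i, IsCMField (K i)] in
/-- Complex conjugation is an involution on `⊔_i Hom(K_i, ℂ)`. [cite: GaoUllmo2025, Thm. 3.1 (3.2)] -/
theorem conj_smul_conj_smul (x : (i : Fin n) × (K i →+* ℂ)) :
    (starRingAut : ℂ ≃+* ℂ) • (starRingAut : ℂ ≃+* ℂ) • x = x := by
  rw [conj_smul_sigma_eq, conj_smul_sigma_eq]
  obtain ⟨i, s⟩ := x
  exact congrArg (Sigma.mk i) (ComplexEmbedding.involutive_conjugate (K i) s)

omit [∀ i, NumberField (K i)] [∀ i, IsCMField (K i)] in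
/-- `ρ • ρ • S = S` for a weight `S`. [cite: GaoUllmo2025, Thm. 3.1 (3.2)] -/
theorem conj_smul_conj_smul_finset (S : Finset ((i : Fin n) × (K i →+* ℂ))) :
    (starRingAut : ℂ ≃+* ℂ) • (starRingAut : ℂ ≃+* ℂ) • S = S := by
  ext x
  constructor
  · intro hx
    obtain ⟨y, hy, rfl⟩ := Finset.mem_smul_finset.1 hx
    obtain ⟨z, hz, rfl⟩ := Finset.mem_smul_finset.1 hy
    rwa [conj_smul_conj_smul]
  · intro hx
    rw [← conj_smul_conj_smul x]
    exact Finset.smul_mem_smul_finset (Finset.smul_mem_smul_finset hx)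

omit [∀ i, NumberField (K i)] [∀ i, IsCMField (K i)] in
/-- `s̄ ∈ Φ ↔ s ∉ Φ` on `⊔_i Hom(K_i, ℂ)`: the conjugate of `x` lies in the type iff `x` does not. [cite: GaoUllmo2025, Thm. 3.1 (3.2)] -/
theorem conj_smul_mem_iff (Φ : ∀ i, CMType (K i)) (x : (i : Fin n) × (K i →+* ℂ)) :
    ((starRingAut : ℂ ≃+* ℂ) • x).2 ∈ (Φ ((starRingAut : ℂ ≃+* ℂ) • x).1).1 ↔ x.2 ∉ (Φ x.1).1 := by
  rw [conj_smul_sigma_eq]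
  change ComplexEmbedding.conjugate x.2 ∈ (Φ x.1).1 ↔ x.2 ∉ (Φ x.1).1
  rw [(Φ x.1).2 (ComplexEmbedding.conjugate x.2), ComplexEmbedding.involutive_conjugate (K x.1) x.2]

omit [∀ i, NumberField (K i)] [∀ i, IsCMField (K i)] in
/-- No point of `⊔_i Hom(K_i, ℂ)` is its own conjugate (`s ∈ Φ ↔ s̄ ∉ Φ`). [cite: GaoUllmo2025, Thm. 3.1 (3.2)] -/
theorem conj_smul_ne_self (Φ : ∀ i, CMType (K i)) (x : (i : Fin n) × (K i →+* ℂ)) :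
    (starRingAut : ℂ ≃+* ℂ) • x ≠ x := by
  intro h
  have h1 := conj_smul_mem_iff Φ x
  rw [h] at h1
  exact (iff_not_self h1).elim

/-- **Counting along conjugation**: the members of `ρ • D` that `τ` sends INTO the type are as many as the members of
`D` that `τ` sends OUTSIDE it (`τ ρ = ρ τ` and `t̄ ∈ Φ ↔ t ∉ Φ`). [cite: GaoUllmo2025, Thm. 3.1 (3.2)] -/
theorem ncard_sep_conj_smul_mem (Φ : ∀ i, CMType (K i)) (τ : ℂ ≃+* ℂ)
    (D : Finset ((i : Fin n) × (K i →+* ℂ))) :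
    {x | x ∈ (starRingAut : ℂ ≃+* ℂ) • D ∧ (τ : ℂ →+* ℂ).comp x.2 ∈ (Φ x.1).1}.ncard =
      {x | x ∈ D ∧ (τ : ℂ →+* ℂ).comp x.2 ∉ (Φ x.1).1}.ncard := by
  have key : ∀ y : (i : Fin n) × (K i →+* ℂ),
      (τ : ℂ →+* ℂ).comp ((starRingAut : ℂ ≃+* ℂ) • y).2 ∈ (Φ ((starRingAut : ℂ ≃+* ℂ) • y).1).1 ↔
        (τ : ℂ →+* ℂ).comp y.2 ∉ (Φ y.1).1 := by
    intro y
    have e : (τ • (starRingAut : ℂ ≃+* ℂ) • y) = (starRingAut : ℂ ≃+* ℂ) • τ • y := smul_conj_smul_comm τ y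
    have e1 : (⟨((starRingAut : ℂ ≃+* ℂ) • y).1, (τ : ℂ →+* ℂ).comp ((starRingAut : ℂ ≃+* ℂ) • y).2⟩ :
        (i : Fin n) × (K i →+* ℂ)) = (starRingAut : ℂ ≃+* ℂ) • τ • y := by rw [← smul_sigma_eq]; exact e
    have h := conj_smul_mem_iff Φ (τ • y)
    rw [← e1] at h
    exact h
  rw [show {x | x ∈ (starRingAut : ℂ ≃+* ℂ) • D ∧ (τ : ℂ →+* ℂ).comp x.2 ∈ (Φ x.1).1} =
      (fun y => (starRingAut : ℂ ≃+* ℂ) • y) '' {x | x ∈ D ∧ (τ : ℂ →+* ℂ).comp x.2 ∉ (Φ x.1).1} by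
    ext x
    simp only [Set.mem_setOf_eq, Finset.mem_smul_finset, Set.mem_image]
    constructor
    · rintro ⟨⟨y, hy, rfl⟩, hΦ⟩
      exact ⟨y, ⟨hy, (key y).1 hΦ⟩, rfl⟩
    · rintro ⟨y, ⟨hy, hΦ⟩, rfl⟩
      exact ⟨⟨y, hy, rfl⟩, (key y).2 hΦ⟩,
    Set.ncard_image_of_injective _ (MulAction.injective (starRingAut : ℂ ≃+* ℂ))]

/-- Companion count: the members of `ρ • D` that `τ` sends OUTSIDE the type are as many as the members of `D`
that `τ` sends into it. [cite: GaoUllmo2025, Thm. 3.1 (3.2)] -/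
theorem ncard_sep_conj_smul_not_mem (Φ : ∀ i, CMType (K i)) (τ : ℂ ≃+* ℂ)
    (D : Finset ((i : Fin n) × (K i →+* ℂ))) :
    {x | x ∈ (starRingAut : ℂ ≃+* ℂ) • D ∧ (τ : ℂ →+* ℂ).comp x.2 ∉ (Φ x.1).1}.ncard =
      {x | x ∈ D ∧ (τ : ℂ →+* ℂ).comp x.2 ∈ (Φ x.1).1}.ncard := by
  have h := ncard_sep_conj_smul_mem Φ τ ((starRingAut : ℂ ≃+* ℂ) • D)
  rw [conj_smul_conj_smul_finset] at h
  exact h.symm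

omit [∀ i, NumberField (K i)] [∀ i, IsCMField (K i)] in
/-- `{x} ∪ {ρ x}` is a disjoint union. [cite: GaoUllmo2025, Thm. 3.1 (3.2)] -/
theorem disjoint_singleton_conj_smul (Φ : ∀ i, CMType (K i)) (x : (i : Fin n) × (K i →+* ℂ)) :
    Disjoint ({x} : Finset ((i : Fin n) × (K i →+* ℂ))) ((starRingAut : ℂ ≃+* ℂ) • ({x} : Finset _)) := by
  rw [Finset.smul_finset_singleton, Finset.disjoint_singleton_left, Finset.mem_singleton]
  exact fun h => conj_smul_ne_self Φ x h.symm

/-- **The conjugate pair `{x, x̄}` is balanced** (for every `τ` exactly one of `τ ∘ s`, `τ ∘ s̄ = (τ ∘ s)‾` lies in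
the type): the weight of a divisor class. [cite: Gordon1999HodgeAVSurvey, §9.2 (9.2.1)] -/
theorem isGaloisBalancedAlg_pair_conj (Φ : ∀ i, CMType (K i)) (x : (i : Fin n) × (K i →+* ℂ)) :
    IsGaloisBalancedAlg Φ ({x} ∪ (starRingAut : ℂ ≃+* ℂ) • ({x} : Finset ((i : Fin n) × (K i →+* ℂ)))) := by
  have hd := disjoint_singleton_conj_smul Φ x
  intro τ
  rw [ncard_sep_union_of_disjoint hd, ncard_sep_union_of_disjoint hd, ncard_sep_conj_smul_mem,
    ncard_sep_conj_smul_not_mem, add_comm]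

/-- **THE SPLITTING LEMMA.** If `A ⊔ D` and `A ⊔ ρ•D` both satisfy Pohlmann's condition (both unions disjoint,
`ρ • D` = the conjugates of the members of `D`), then `A` and `D` satisfy it: writing `a±`, `d±` for the numbers of
members of `A`, `D` sent by `τ` into / outside the type, the hypotheses read `a⁺ + d⁺ = a⁻ + d⁻` and
`a⁺ + d⁻ = a⁻ + d⁺`, whence `a⁺ = a⁻` and `d⁺ = d⁻`. [cite: GaoUllmo2025, Thm. 3.1 (3.2)] -/
theorem isGaloisBalancedAlg_split (Φ : ∀ i, CMType (K i)) {A D : Finset ((i : Fin n) × (K i →+* ℂ))}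
    (hAD : Disjoint A D) (hAD' : Disjoint A ((starRingAut : ℂ ≃+* ℂ) • D))
    (h₁ : IsGaloisBalancedAlg Φ (A ∪ D)) (h₂ : IsGaloisBalancedAlg Φ (A ∪ (starRingAut : ℂ ≃+* ℂ) • D)) :
    IsGaloisBalancedAlg Φ A ∧ IsGaloisBalancedAlg Φ D := by
  have key : ∀ τ : ℂ ≃+* ℂ,
      {x | x ∈ A ∧ (τ : ℂ →+* ℂ).comp x.2 ∈ (Φ x.1).1}.ncard =
          {x | x ∈ A ∧ (τ : ℂ →+* ℂ).comp x.2 ∉ (Φ x.1).1}.ncard ∧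
        {x | x ∈ D ∧ (τ : ℂ →+* ℂ).comp x.2 ∈ (Φ x.1).1}.ncard =
          {x | x ∈ D ∧ (τ : ℂ →+* ℂ).comp x.2 ∉ (Φ x.1).1}.ncard := by
    intro τ
    have e₁ := h₁ τ
    have e₂ := h₂ τ
    rw [ncard_sep_union_of_disjoint hAD, ncard_sep_union_of_disjoint hAD] at e₁
    rw [ncard_sep_union_of_disjoint hAD', ncard_sep_union_of_disjoint hAD', ncard_sep_conj_smul_mem,
      ncard_sep_conj_smul_not_mem] at e₂
    omega
  exact ⟨fun τ => (key τ).1, fun τ => (key τ).2⟩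

omit [∀ i, NumberField (K i)] [∀ i, IsCMField (K i)] in
/-- **Balancedness is `Aut(ℂ)`-invariant**: if `S` satisfies Pohlmann's condition, so does `τ • S`
(the condition for `τ • S` at `σ` is the condition for `S` at `σ τ`). [cite: GaoUllmo2025, Thm. 3.1 (3.2)] -/
theorem isGaloisBalancedAlg_smul {Φ : ∀ i, CMType (K i)} {S : Finset ((i : Fin n) × (K i →+* ℂ))}
    (hS : IsGaloisBalancedAlg Φ S) (τ : ℂ ≃+* ℂ) : IsGaloisBalancedAlg Φ (τ • S) := by
  have count : ∀ (Q : ∀ i, (K i →+* ℂ) → Prop),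
      {x | x ∈ τ • S ∧ Q x.1 x.2}.ncard = {x | x ∈ S ∧ Q x.1 ((τ : ℂ →+* ℂ).comp x.2)}.ncard := by
    intro Q
    rw [show {x | x ∈ τ • S ∧ Q x.1 x.2} = (fun y => τ • y) '' {x | x ∈ S ∧ Q x.1 ((τ : ℂ →+* ℂ).comp x.2)} by
      ext x
      simp only [Set.mem_setOf_eq, Finset.mem_smul_finset, Set.mem_image]
      constructor
      · rintro ⟨⟨y, hy, rfl⟩, hQ⟩; exact ⟨y, ⟨hy, hQ⟩, rfl⟩
      · rintro ⟨y, ⟨hy, hQ⟩, rfl⟩; exact ⟨⟨y, hy, rfl⟩, hQ⟩,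
      Set.ncard_image_of_injective _ (MulAction.injective τ)]
  intro σ
  rw [count (fun i s => (σ : ℂ →+* ℂ).comp s ∈ (Φ i).1), count (fun i s => (σ : ℂ →+* ℂ).comp s ∉ (Φ i).1)]
  exact hS (τ.trans σ)

end Action

end Literature.AlgebraicGeometry.ComplexMultiplication.CMWeights

end
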